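/-
Copyright (c) 2026. Released under the Apache 2.0 license.
-/
import Literature.NumberTheory.EllipticCurves.ManinConstantQuadraticTwistCremonaDeterminedRangeProofs
import Literature.NumberTheory.EllipticCurves.ManinConstantClassCertificateTwistCremonaRange
import HarnessLib

/-!
# The named predicate of the level-bounded twist-descent road: `IsTwistLevelBoundCovered B W` —
# ONE odd prime of Kodaira type `Iₙ*` (or a displayed twist witness) whose twist partner has
# conductor `≤ B`; at `B = 130000` it is `IsTwistCremonaRangeCovered` (Agashe–Ribet–Stein 2006
# Thm. 2.6), at `B = 400000` the road into Cremona's DETERMINED range (named input `h40`)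

This small file NAMES the hypothesis of the kernel theorem
`classAbsManinConstantEqOne_of_forall_exists_kodairaIstar_or_twist_of_level_le_bound`
(`ManinConstantQuadraticTwistLevelBoundProofs.lean`) as a class predicate with the level bound as a
parameter, `IsTwistLevelBoundCovered (B : ℕ) (W : WeierstrassCurve ℚ)`, in the format of the tree's
earlier class certificates (`IsEdixhovenCesnaviciusTwistCovered`, `IsEdixhovenKodairaTwistCovered`,
`IsTwistCremonaRangeCovered`): EVERY globally minimal member `W'` of the isogeny class of `W` has
SOME odd prime `p` with ONE of
* the Kodaira symbol of `W'` at `p` is `I₀*` and `N(W') ≤ B·p²` (partner conductor `N(W')/p²`);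
* the Kodaira symbol of `W'` at `p` is `I_ν*` for some `ν ≥ 1` and `N(W') ≤ B·p` (partner `N(W')/p`);
* a displayed twist witness `TwistSemistableWitnessAt W' p` and `N(W') ≤ B·p`.
At `B = 130000` this is, by `Iff.rfl`, the tree's `IsTwistCremonaRangeCovered W`
(`ManinConstantClassCertificateTwistCremonaRange.lean`, the booked road); the predicate is MONOTONE
in `B`. Constructors `ClassAbsManinConstantEqOne W` from it: generic (`B hB hnf`, `hB` the displayed
level-`B` Manin datum), at `B = 400000` from the named input
`h40 = cremona_abs_maninConstant_eq_one_of_level_le_400000` (Cremona's DETERMINED range: optimality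
code `1` and `mc = 1` on the optimal curve of every class of conductor `≤ 400000`, `ecdata/manin.txt`;
referee A ROUND 325 «α with named dependency»; DATUM grade), and at `B = 300000` from
`h30 = cremona_abs_maninConstant_eq_one_of_level_le_300000` (Česnavičius–Neururer–Saha 2024 §1, the
refereed sentence citing the database). The `B = 400000` instance is the one that reaches Kodaira
type `I_ν*` at `3` for `390000 < N < 500000` (partner level `N/3 ∈ (130000, 166667]`, where Cremona's
optimal curve is determined); the table-form constructor
`isTwistLevelBoundCovered_400000_of_forall_conductorNorm_lt_500000_of_exists_kodairaIstar` takes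
«conductor `< 500000` and an odd prime of Kodaira type `Iₙ*` on every globally minimal member».
Definitions and their unfolding lemmas only; every constructor is one line from the proofs files.
Nothing is booked here; tier words are the referee's.

## References
* [Cremona2022ManinConstants] J. E. Cremona, *Manin constants and optimal curves*, `ecdata/manin.txt`
  ¶1–2, ¶ "Concerning the Manin constant", "Data files".
* [CesnaviciusNeururerSaha2023] K. Česnavičius, M. Neururer, A. Saha, JEMS 26 (2024), §1.
* [AgasheRibetStein2006] A. Agashe, K. Ribet, W. A. Stein, *The Manin constant*, with an appendix
  by J. Cremona, Pure Appl. Math. Q. 2 (2006) 617–636: Thm. 2.6 (p. 619), appendix §5.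
* [Stevens1989] G. Stevens, Invent. Math. 98 (1989), Lemmas (5.2), (5.4).
* [SilvermanATAEC1994] J. H. Silverman, *ATAEC*, IV.9 Table 4.1 and IV.11.1 table p. 368.
-/

noncomputable section

open scoped MatrixGroups ModularForm

open CongruenceSubgroup WeierstrassCurve

namespace Literature.NumberTheory.EllipticCurves.ModularForms

/-- **The "twist–level-`B` covered" classes**: every globally minimal member `W'` of the class of
`W` has an odd prime `p` at which EITHER the Kodaira symbol of `W'` is `I₀*` and `N(W') ≤ B·p²`, OR
it is `I_ν*` for some `ν ≥ 1` and `N(W') ≤ B·p`, OR a twist witness `TwistSemistableWitnessAt W' p`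
is displayed and `N(W') ≤ B·p` — so that the class is the `χ_{p*}`-twist of a class semistable at `p`
whose conductor is at most `B`. A predicate with the bound as parameter; nothing asserted.
[cite: AgasheRibetStein2006, Thm. 2.6 (the case B = 130000)]
[cite: Cremona2022ManinConstants, manin.txt ¶1–2 (the case B = 400000)]
[cite: SilvermanATAEC1994, IV.11.1 table p. 368] [cite: Stevens1989, Lemmas (5.2), (5.4)] -/
def IsTwistLevelBoundCovered (B : ℕ) (W : WeierstrassCurve ℚ) : Prop :=
  ∀ (W' : WeierstrassCurve ℚ) [W'.IsElliptic] [W'.IsGloballyMinimal], IsIsogenous W W' →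
    ∃ (p : ℕ) (hp : p.Prime), p ≠ 2 ∧
      ((W'.kodairaSymbolAt ((Rat.HeightOneSpectrum.primesEquiv (R := ℤ)).symm ⟨p, hp⟩) = .Istar 0 ∧
          W'.conductorNorm ℤ ≤ B * p ^ 2) ∨
       ((∃ n : ℕ,
          W'.kodairaSymbolAt ((Rat.HeightOneSpectrum.primesEquiv (R := ℤ)).symm ⟨p, hp⟩) =
            .Istar (n + 1)) ∧ W'.conductorNorm ℤ ≤ B * p) ∨
       (@TwistSemistableWitnessAt W' p ⟨hp⟩ ∧ W'.conductorNorm ℤ ≤ B * p))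

/-- Unfolding of `IsTwistLevelBoundCovered` (by `Iff.rfl`). [cite: AgasheRibetStein2006, Thm. 2.6] -/
theorem isTwistLevelBoundCovered_iff (B : ℕ) (W : WeierstrassCurve ℚ) :
    IsTwistLevelBoundCovered B W ↔
      ∀ (W' : WeierstrassCurve ℚ) [W'.IsElliptic] [W'.IsGloballyMinimal], IsIsogenous W W' →
        ∃ (p : ℕ) (hp : p.Prime), p ≠ 2 ∧
          ((W'.kodairaSymbolAt ((Rat.HeightOneSpectrum.primesEquiv (R := ℤ)).symm ⟨p, hp⟩) =
                .Istar 0 ∧ W'.conductorNorm ℤ ≤ B * p ^ 2) ∨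
           ((∃ n : ℕ,
              W'.kodairaSymbolAt ((Rat.HeightOneSpectrum.primesEquiv (R := ℤ)).symm ⟨p, hp⟩) =
                .Istar (n + 1)) ∧ W'.conductorNorm ℤ ≤ B * p) ∨
           (@TwistSemistableWitnessAt W' p ⟨hp⟩ ∧ W'.conductorNorm ℤ ≤ B * p)) :=
  Iff.rfl

/-- At `B = 130000` the predicate IS the tree's `IsTwistCremonaRangeCovered` (by `Iff.rfl`).
[cite: AgasheRibetStein2006, Thm. 2.6 (p. 619)] -/
theorem isTwistCremonaRangeCovered_iff_isTwistLevelBoundCovered (W : WeierstrassCurve ℚ) :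
    IsTwistCremonaRangeCovered W ↔ IsTwistLevelBoundCovered 130000 W :=
  Iff.rfl

/-- The predicate is monotone in the bound: a class covered at `B` is covered at every `B' ≥ B`
(the three level clauses are upper bounds). [cite: AgasheRibetStein2006, Thm. 2.6 (the B = 130000 case)]
[cite: Cremona2022ManinConstants, manin.txt ¶1–2 (the B = 400000 case)] -/
theorem IsTwistLevelBoundCovered.mono {B B' : ℕ} (hBB' : B ≤ B') {W : WeierstrassCurve ℚ}
    (h : IsTwistLevelBoundCovered B W) : IsTwistLevelBoundCovered B' W := by
  intro W' _ _ hiso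
  obtain ⟨p, hp, hp2, hc⟩ := h W' hiso
  refine ⟨p, hp, hp2, ?_⟩
  rcases hc with ⟨hK, hl⟩ | ⟨hK, hl⟩ | ⟨hw, hl⟩
  · exact Or.inl ⟨hK, hl.trans (Nat.mul_le_mul_right _ hBB')⟩
  · exact Or.inr (Or.inl ⟨hK, hl.trans (Nat.mul_le_mul_right _ hBB')⟩)
  · exact Or.inr (Or.inr ⟨hw, hl.trans (Nat.mul_le_mul_right _ hBB')⟩)

/-- In particular a twist–Cremona-range covered class (`B = 130000`) is covered at `B = 400000`.
[cite: AgasheRibetStein2006, Thm. 2.6] [cite: Cremona2022ManinConstants, manin.txt ¶1–2] -/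
theorem IsTwistCremonaRangeCovered.isTwistLevelBoundCovered_400000 {W : WeierstrassCurve ℚ}
    (h : IsTwistCremonaRangeCovered W) : IsTwistLevelBoundCovered 400000 W :=
  IsTwistLevelBoundCovered.mono (by norm_num)
    ((isTwistCremonaRangeCovered_iff_isTwistLevelBoundCovered W).mp h)

/-- A class all of whose globally minimal members have an odd prime of Kodaira type `Iₙ*` (some
`n ≥ 0`) with the uniform level bound `N(W') ≤ B·p` is twist–level-`B` covered (first or second
disjunct; `B·p ≤ B·p²`). [cite: SilvermanATAEC1994, IV.11.1 table p. 368] -/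
theorem isTwistLevelBoundCovered_of_forall_exists_kodairaIstar {B : ℕ} {W : WeierstrassCurve ℚ}
    (h : ∀ (W' : WeierstrassCurve ℚ) [W'.IsElliptic] [W'.IsGloballyMinimal], IsIsogenous W W' →
      ∃ (p : ℕ) (hp : p.Prime), p ≠ 2 ∧
        (∃ n : ℕ,
          W'.kodairaSymbolAt ((Rat.HeightOneSpectrum.primesEquiv (R := ℤ)).symm ⟨p, hp⟩) = .Istar n) ∧
          W'.conductorNorm ℤ ≤ B * p) :
    IsTwistLevelBoundCovered B W := by
  intro W' _ _ hiso
  obtain ⟨p, hp, hp2, ⟨n, hK⟩, hlev⟩ := h W' hiso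
  refine ⟨p, hp, hp2, ?_⟩
  cases n with
  | zero =>
    refine Or.inl ⟨hK, hlev.trans ?_⟩
    have : p ≤ p ^ 2 := by rw [pow_two]; exact Nat.le_mul_of_pos_left p hp.pos
    exact Nat.mul_le_mul_left B this
  | succ n => exact Or.inr (Or.inl ⟨⟨n, hK⟩, hlev⟩)

/-- A class all of whose globally minimal members carry a displayed twist witness at an odd prime
`p` with `N(W') ≤ B·p` is twist–level-`B` covered (third disjunct).
[cite: Stevens1989, Lemmas (5.2), (5.4)] -/
theorem isTwistLevelBoundCovered_of_forall_exists_twistSemistableWitnessAt {B : ℕ}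
    {W : WeierstrassCurve ℚ}
    (h : ∀ (W' : WeierstrassCurve ℚ) [W'.IsElliptic] [W'.IsGloballyMinimal], IsIsogenous W W' →
      ∃ (p : ℕ) (hp : p.Prime), @TwistSemistableWitnessAt W' p ⟨hp⟩ ∧
        W'.conductorNorm ℤ ≤ B * p) :
    IsTwistLevelBoundCovered B W := by
  intro W' _ _ hiso
  obtain ⟨p, hp, htw, hlev⟩ := h W' hiso
  exact ⟨p, hp, htw.1, Or.inr (Or.inr ⟨htw, hlev⟩)⟩

/-- **The TABLE-form constructor on Cremona's range** (`B = 400000`): if every globally minimal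
member `W'` has conductor `< 500000` and an odd prime `p` of Kodaira type `Iₙ*` (any `n ≥ 0`), the
class is twist–level-`400000` covered, since `N(W') < 500000 ≤ 400000·3 ≤ 400000·p`.
[cite: Cremona2022ManinConstants, manin.txt ¶1–2] [cite: SilvermanATAEC1994, IV.11.1 table p. 368] -/
theorem isTwistLevelBoundCovered_400000_of_forall_conductorNorm_lt_500000_of_exists_kodairaIstar
    {W : WeierstrassCurve ℚ}
    (h : ∀ (W' : WeierstrassCurve ℚ) [W'.IsElliptic] [W'.IsGloballyMinimal], IsIsogenous W W' →
      W'.conductorNorm ℤ < 500000 ∧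
        ∃ (p : ℕ) (hp : p.Prime), p ≠ 2 ∧
          ∃ n : ℕ,
            W'.kodairaSymbolAt ((Rat.HeightOneSpectrum.primesEquiv (R := ℤ)).symm ⟨p, hp⟩) = .Istar n) :
    IsTwistLevelBoundCovered 400000 W := by
  refine isTwistLevelBoundCovered_of_forall_exists_kodairaIstar fun W' _ _ hiso ↦ ?_
  obtain ⟨hlt, p, hp, hp2, n, hK⟩ := h W' hiso
  refine ⟨p, hp, hp2, ⟨n, hK⟩, ?_⟩
  have h3 : 3 ≤ p := by
    have h2 := hp.two_le
    omega
  calc W'.conductorNorm ℤ ≤ 400000 * 3 := by omega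
    _ ≤ 400000 * p := Nat.mul_le_mul_left 400000 h3

/-- **The class certificate BY NAME at a generic bound — binders `hB hnf`**: for the displayed
level-`B` Manin datum `hB` (every optimal `X₀`-datum of level `≤ B` has `|c| = 1`),
`IsTwistLevelBoundCovered B W → ClassAbsManinConstantEqOne W`; the kernel theorem
`classAbsManinConstantEqOne_of_forall_exists_kodairaIstar_or_twist_of_level_le_bound` under its
named hypothesis. [cite: AgasheRibetStein2006, Thm. 2.6 and appendix §5 (method)]
[cite: Stevens1989, Lemmas (5.2), (5.4)] [cite: SilvermanATAEC1994, IV.11.1 table p. 368] -/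
theorem classAbsManinConstantEqOne_of_isTwistLevelBoundCovered (B : ℕ)
    (hB : ∀ (V : WeierstrassCurve ℚ) [V.IsElliptic] [V.IsGloballyMinimal] {M : ℕ} [NeZero M]
      (DV : ModularParametrizationData V M),
      (∀ z ∈ DV.L.lattice, ∃ w ∈ periodLattice DV.f, z = DV.c * w) → M ≤ B →
        |DV.maninConstant| = 1)
    (hnf : exists_isNewformOf)
    (W : WeierstrassCurve ℚ) (hcov : IsTwistLevelBoundCovered B W) :
    ClassAbsManinConstantEqOne W :=
  classAbsManinConstantEqOne_of_forall_exists_kodairaIstar_or_twist_of_level_le_bound B hB hnf W hcov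

/-- **The class certificate BY NAME at Cremona's DETERMINED range — binders `h40 hnf`**:
`IsTwistLevelBoundCovered 400000 W → ClassAbsManinConstantEqOne W`, the named input
`h40 = cremona_abs_maninConstant_eq_one_of_level_le_400000` being consumed at the PARTNER class
(conductor `≤ N(W')/p ≤ 400000`, where Cremona's optimal curve is determined).
[cite: Cremona2022ManinConstants, manin.txt ¶1–2, ¶ "Concerning the Manin constant", "Data files"]
[cite: Stevens1989, Lemmas (5.2), (5.4)] [cite: SilvermanATAEC1994, IV.11.1 table p. 368] -/
theorem classAbsManinConstantEqOne_of_isTwistLevelBoundCovered_400000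
    (h40 : cremona_abs_maninConstant_eq_one_of_level_le_400000)
    (hnf : exists_isNewformOf)
    (W : WeierstrassCurve ℚ) (hcov : IsTwistLevelBoundCovered 400000 W) :
    ClassAbsManinConstantEqOne W :=
  classAbsManinConstantEqOne_of_forall_exists_kodairaIstar_or_twist_of_level_le_400000 h40 hnf W hcov

/-- The same certificate at the refereed-secondary bound `B = 300000` — binders `h30 hnf`.
[cite: CesnaviciusNeururerSaha2023, §1] [cite: Stevens1989, Lemmas (5.2), (5.4)] -/
theorem classAbsManinConstantEqOne_of_isTwistLevelBoundCovered_300000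
    (h30 : cremona_abs_maninConstant_eq_one_of_level_le_300000)
    (hnf : exists_isNewformOf)
    (W : WeierstrassCurve ℚ) (hcov : IsTwistLevelBoundCovered 300000 W) :
    ClassAbsManinConstantEqOne W :=
  classAbsManinConstantEqOne_of_forall_exists_kodairaIstar_or_twist_of_level_le_300000 h30 hnf W hcov

/-- The binder form carried by consumers at `B = 400000`: `p ∤ c` for EVERY prime `p` and every
lattice-optimal `X₀`-datum of every globally minimal member, modulo `h40 hnf`.
[cite: Cremona2022ManinConstants, manin.txt ¶1–2] [cite: Stevens1989, Lemmas (5.2), (5.4)] -/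
theorem not_dvd_maninConstant_of_isTwistLevelBoundCovered_400000
    (h40 : cremona_abs_maninConstant_eq_one_of_level_le_400000)
    (hnf : exists_isNewformOf)
    {W : WeierstrassCurve ℚ} (hcov : IsTwistLevelBoundCovered 400000 W)
    (W' : WeierstrassCurve ℚ) [W'.IsElliptic] [W'.IsGloballyMinimal] {N' : ℕ} [NeZero N']
    (D' : ModularParametrizationData W' N') (hiso : IsIsogenous W W')
    (hopt : ∀ z ∈ D'.L.lattice, ∃ w ∈ periodLattice D'.f, z = D'.c * w)
    (p : ℕ) (hp : p.Prime) : ¬ (p : ℤ) ∣ D'.maninConstant :=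
  (classAbsManinConstantEqOne_of_isTwistLevelBoundCovered_400000 h40 hnf W hcov).not_dvd_maninConstant
    D' hiso hopt hp

/-- The valuation form at `B = 400000` (`ord_p c = 0`, the record-side binder shape).
[cite: Cremona2022ManinConstants, manin.txt ¶1–2] -/
theorem padicValInt_maninConstant_eq_zero_of_isTwistLevelBoundCovered_400000
    (h40 : cremona_abs_maninConstant_eq_one_of_level_le_400000)
    (hnf : exists_isNewformOf)
    {W : WeierstrassCurve ℚ} (hcov : IsTwistLevelBoundCovered 400000 W)
    (W' : WeierstrassCurve ℚ) [W'.IsElliptic] [W'.IsGloballyMinimal] {N' : ℕ} [NeZero N']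
    (D' : ModularParametrizationData W' N') (hiso : IsIsogenous W W')
    (hopt : ∀ z ∈ D'.L.lattice, ∃ w ∈ periodLattice D'.f, z = D'.c * w)
    (p : ℕ) [hp : Fact p.Prime] : padicValInt p D'.maninConstant = 0 :=
  (classAbsManinConstantEqOne_of_isTwistLevelBoundCovered_400000 h40 hnf W
    hcov).padicValInt_maninConstant_eq_zero D' hiso hopt p

end Literature.NumberTheory.EllipticCurves.ModularForms

end
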